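import Literature.MathematicalPhysics.QuantumFieldTheory.Balaban1983to89.B9Thm314GFlatV1DivTransfer
import Literature.MathematicalPhysics.QuantumFieldTheory.Balaban1983to89.B6HolderPairMemberV1

/-!
# `Balaban1983to89.B9Thm314GFlatV1DivHolder` — T. Bałaban, *Propagators for lattice gauge theories in a background field*,
# Commun. Math. Phys. **99** (1985) 389–434 [Balaban1985BackgroundPropagators], **THEOREM 3.14 (pp. 426–427, (3.154)) AT `U = 1` FOR THE
# GENUINE `k`-LEVEL `G = Δ_a⁻¹` ((2.19)/(2.22) of [4] = [Balaban1984PropagatorsII]) ON THE V1 TORUS: THE HÖLDER MEMBER (2.137)₂ (`G∇*`, pair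
# difference) GIVEN THE ONE-FAMILY MAJORANTS** — for fine bonds `f₁ ∈ B(y)`, `f₂`, `supp μ ⊂ B′(y′)`, `|μ| ≤ B`:
# `|[(G[Ω]∇*_νμ)(f₁) − (G[Ω]∇*_νμ)(f₂)] − [(G[Ω′]∇*_νμ)(f₁) − (G[Ω′]∇*_νμ)(f₂)]| ≤ C·√ψ(y)·√(φ(y)·|c_f|/L^k)·B·e^{−δ·min(d,d′)(y,y′)}·e^{−δ·d(y,y′,Ω)}`
# whenever (i) the pair operators `P_{f₁,f₂}∘(G[Ω]∇*_ν)`, `P_{f₁,f₂}∘(G[Ω′]∇*_ν)` carry majorants `A₃ψ(a)e^{−δ₃d}`, `A₃ψ′(a)e^{−δ₃d′}` (the printed shape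
# of (2.137)₂ with the Hölder gain inside `ψ`), (ii) `P_{f₁,f₂}∘G[Ω]` carries `A₁φ(a)e^{−δ₃d}` (the pair majorant of `G` itself, [4] Prop. 2.5 (1.110)),
# (iii) `G[Ω′]∇*_ν` carries the (2.136)₃ majorant `A₂(L^{j(a)}|c_f|⁻¹)e^{−δ₃d′}` — all three one-family inputs are p22's/p38's lane; the engine is
# `B9Thm314GFlatV1DivTransfer.engine_lin` (linear inner profile, general outer prefactor); theorems only; no existing module is touched; no
# definition, no fact is minted

statement-level skeleton of published theorems with citation tags; proofs where landed; nothing here is a claim about the Yang–Mills mass gap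

PDF held: `paper:balaban1985-cmp99-background-propagators` (journal page = PDF page + 388), pp. 426–427 [PDF 38–39] (Theorem 3.14, (3.154));
`paper:balaban1984-cmp96-propagators-rt-ii` (journal page = PDF page + 222), p. 247 [PDF 25], render `1984-cmp96-propagators-rt-II-p025-x2.png`
re-read this generation: Proposition 2.6 (2.137) «‖ζ∇GJ‖_α, ‖ζG∇*J‖_α ≦ O(1)(Lʲη)^{1−α}(‖ζ‖_α^ξ + |ζ|)e^{−δ₃d(y,y′)}|J|, ξ = L^{−j} … for 0 ≦ α < 1,
ζ ∈ C₀^∞(Δ̃(y)) …, supp J ⊂ Δ(y′)»; [Balaban1984PropagatorsI] (1.109)–(1.110) p. 35.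

CITATION HEADER (lean-in-tree rule) — WHAT IS REPRODUCED.  Phase-2 file of the `lit-balaban` typed skeleton (HOME `run/shared/lean/pub/lit-balaban/`),
unit `lit-balaban-p21` (proof seat p21, gen 23; B9 fold owner r06, referee ref-4); SKELETON row B9.Thm3.14 (member cell: Thm 3.14 at `U = 1` for the
genuine `k`-level `G = Δ_a⁻¹`, the Hölder member (2.137)₂, modulo the one-family inputs).  Companions: `B9Thm314GFlatV1Kernel` (FILE 1),
`B9Thm314GFlatV1Transfer` (FILE 2), `B9Thm314GFlatV1MultiLevelTorus` ((2.136)₄), `B9Thm314GFlatV1DivTransfer` ((2.136)₃, (2.140)₁₋₃, the linear-profile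
engine), `B9Thm314GFlatV1Holder` ((2.137)₁).  `P_{f₁,f₂}` is p22's `B6HolderPairMemberV1.pairOp` BY NAME.

## WHAT THIS FILE CERTIFIES (kernel-checked)

* §0 **`hasMajorant_pairOp_comp_of_le`** — glue for the instantiations (here and in `B9Thm314GFlatV1Holder`): a pair majorant of `P_{f₁,f₂}·T`
  with any kernel `K` (p22's `Module.End`-product shape) dominated at the block of `f₁` by a non-negative `K′` gives `HasMajorant (P_{f₁,f₂} ∘ₗ T) K′`.
* **`thm314_Gdiv_holder_flat_V1_of_majorants`** — THEOREM 3.14 AT `U = 1`, THE HÖLDER MEMBER (2.137)₂ FOR `G = Δ_a⁻¹` GIVEN THE ONE-FAMILY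
  MAJORANTS: for all `A₁, A₂, A₃ ≥ 0`, `δ₃ > 0` there are `δ, C, M₀ > 0`, `N₀ > 0` (on `d, L`, `[b₀, b₁]`, `A₁, A₂, A₃, δ₃` only) such that for every V1
  torus, every pair of p21 torus families `D, D′` (hypotheses of FILE 2's `thm314_G_flat_V1` verbatim), `c_f ≠ 0`, positive weights in the global
  band agreeing on the common index bonds, a direction `ν`, fine bonds `f₁, f₂`, block prefactors `φ, ψ ≥ 0` (family `{Ω_j}`), `ψ′ ≥ 0` (family
  `{Ω′_j}`) with the three majorants (i)–(iii) above, common top blocks `y ∋ f₁`, `y′` with `ψ′(y) = ψ(y)`, `supp μ ⊂ B′(y′)`, `|μ| ≤ B`: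
  `|[(G[Ω]∇*_νμ)(f₁) − (G[Ω]∇*_νμ)(f₂)] − [(G[Ω′]∇*_νμ)(f₁) − (G[Ω′]∇*_νμ)(f₂)]| ≤ C·(√ψ(y)·√(φ(y)·|c_f|·L^{−k}))·B·e^{−δ·min(d(y,y′),d′(y,y′))}·e^{−δ·d(y,y′,Ω)}`,
  `∇*_ν = B6LapLegKLevelV1.DVa ν c_f`, `G[Ω] = onFun (B6SectAVectorModelV1.GE (domT hN D hk) hcf hw)`.
  Mechanism: `P∘(G∇*) − P∘(G′∇*) = (P∘G)∘(V_P + V_Q)∘(G′∇*)` (FILE 1's `onFun_GE_sub`); the engine half `B9Thm314GFlatV1DivTransfer.engine_lin`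
  (outer `P∘G` with prefactor `φ`, inner profile (iii) of `(G′∇*)μ`) gives `ΘL²c·A₁A₂·(|c_f|/L^k)·φ(y)·B·e^{−½δd(y,y′,Ω)}`; the plain half FILE 2's
  `trivial_bound_gen` (majorants (i)) gives `2A₃ψ(y)·B·e^{−δ·min(d,d′)}`; gen 18's `combined_bound` (geometric mean) gives both factors with the
  prefactor `√(2A₃ψ(y))·√(ΘL²cA₁A₂(|c_f|/L^k)φ(y))`; the two-family (3.49)₄ inputs as in FILE 2 (gen 19's `thm314_P_flat_multiLevelTorus` member 4,
  FILE 1's `dPd_le`, `w_le_of_band`, gen 18's `consts_260_261`).  Inputs BY NAME, restating nothing.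

## HONEST SCOPE

* As `B9Thm314GFlatV1Holder` for (2.137)₁: the PAIR DIFFERENCE at two fine bonds, `f₁` in the top block `B(y)`; the Hölder quotient, the scale factor
  `(Lʲη)^{1−α}` and the admissible range of `(f₁, f₂)` sit inside the GIVEN gains.  The geometric mean is EXPLICIT in the conclusion: with print-like
  gains `ψ = t^α(L^k|c_f|⁻¹)^{1−α}` ((2.137)₂) and `φ·|c_f|/L^k = t·(L^k|c_f|⁻¹)` (the Lipschitz pair bound of `G`, `t = |f₁−f₂|/(L^k|c_f|⁻¹) ≤ 1`) the
  prefactor is `t^{(1+α)/2}(L^k|c_f|⁻¹)^{1−α/2}`, which is `≤ t^α(L^k|c_f|⁻¹)^{1−α}` (the printed shape) exactly when `L^k|c_f|⁻¹ ≤ 1` (blocks below the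
  unit scale, print's `Lʲη ≤ 1`); this file does not assume it and states the mean as is.
* The three one-family inputs are NOT proved here (p22's/p38's lanes: `B6HolderPairMemberV1.holderG_member`-type pair bounds of `G`,
  `B6Prop26DivLegKLevelV1`/`B6Ineq2140GradKLevel(Pad)V1` for (2.136)₃, and the (2.137)₂ chain); `U = 1`; the V1 torus model of the p21 lineage;
  (2.138)–(2.139) are NOT treated.  `δ = ¼·min(δ₃, δ_G, δ₅, ρ)`.
* Nothing is inferred from the manuscript: every step is kernel-checked; the quoted sentences locate the statements.
-/

noncomputable section

open scoped BigOperators Matrix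
open Finset

namespace Literature.MathematicalPhysics.QuantumFieldTheory.Balaban1983to89.B9Thm314GFlatV1DivHolder

open B4Reflection242 (boxDom)
open B6MultiLevelBoxOperator (N0 aPrinted)
open B6MultiLevelTorusOperator (TDomains)
open B6Geom246MultiLevelBox (bset blkOf)
open B6Geom246MultiLevelTorus (geomT triangle_refl_nonneg_T)
open B6RandomWalk (HasMajorant BlockSupp hasMajorant_mono delta3 delta3_pos)
open B6Ineq2133TwoScaleV1 (onFun)
open B6SectAOperatorsV1 (BondIdx)
open B6SectAVectorModelV1 (GE)
open B6GlobalChartV1 (PV blkV1 domT)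
open B6Ineq288MultiLevelTorus (dPd)
open B6Ineq268MultiLevelBox (W W_pos)
open B9Thm314GpFlatTorusGeometry (dOmega dOmega_nonneg)
open B6Prop26KLevelSkeletonV1 (pref pref_nonneg)
open B6CubeWindowV1 (GlobalBand)
open B6LapLegKLevelV1 (DVa)
open B6HolderPairMemberV1 (pairOp pairOp_apply)
open B9Thm314GpFlatMultiLevelTorus (consts_260_261 combined_bound)
open B6Prop26GradKLevelV1 (prop26_2136_grad_kLevel_unconditional_pad_V1)
open B9Thm314PFlatMultiLevelTorus (thm314_P_flat_multiLevelTorus)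
open B9Thm314GFlatV1Kernel (VP VQ onFun_GE_sub dPd_le member4_eq_dPd w_le_of_band)
open B9Thm314GFlatV1Transfer (trivial_bound_gen)
open B9Thm314GFlatV1DivTransfer (engine_lin)

/-! ## §0  Glue for the instantiations: a pair majorant with ANY kernel feeds the hypotheses of this file and of `B9Thm314GFlatV1Holder` -/

section Glue

variable {g : B6.Geometry} {X : Type} [DecidableEq X]

/-- **FROM A PAIR MAJORANT WITH ANY KERNEL TO THE HYPOTHESIS SHAPE OF THE TWO-FAMILY HÖLDER MEMBERS**: if `P_{f₁,f₂}·T` has a majorant `K`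
(p22's shape, `Module.End` product) and `K(y(f₁), ·) ≤ K′(y(f₁), ·)` for a non-negative kernel `K′` (e.g. `K′(a,b) = A₃·φ(a)·e^{−δ₃d(a,b)}`), then
`P_{f₁,f₂} ∘ₗ T` has the majorant `K′` — the output of `P_{f₁,f₂}` lives at `f₁` only (p22's `pairDiff_le_of_hasMajorant` + `hasMajorant_pairOp_mul`).
[cite: Balaban1984PropagatorsI, (1.109) p.35; Balaban1984PropagatorsII, (2.137) p.247; bookkeeping ours] -/
theorem hasMajorant_pairOp_comp_of_le (blk : X → g.Site) (f₁ f₂ : X) (T : Module.End ℝ (X → ℝ)) {K K' : g.Site → g.Site → ℝ}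
    (hK' : ∀ a b, 0 ≤ K' a b) (h : HasMajorant blk (pairOp f₁ f₂ * T) K) (hle : ∀ b, K (blk f₁) b ≤ K' (blk f₁) b) :
    HasMajorant blk (pairOp f₁ f₂ ∘ₗ T) K' := by
  have h' : HasMajorant blk (pairOp f₁ f₂ * T) K' :=
    B6HolderPairMemberV1.hasMajorant_pairOp_mul blk f₁ f₂ hK' fun y' μ B hμ =>
      (B6HolderPairMemberV1.pairDiff_le_of_hasMajorant blk f₁ f₂ h y' μ B hμ).trans (mul_le_mul_of_nonneg_right (hle y') hμ.nonneg)
  rwa [Module.End.mul_eq_comp] at h'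

end Glue

/-! ## THEOREM 3.14 AT `U = 1`: the Hölder member (2.137)₂ (`G∇*`, pair difference) for `G = Δ_a⁻¹`, given the one-family majorants -/

/-- **THEOREM 3.14 AT `U = 1` — THE HÖLDER MEMBER (2.137)₂ (PAIR DIFFERENCE OF `G∇*_ν`) WITH THE FACTOR (3.154) FOR THE GENUINE `k`-LEVEL
`G = Δ_a⁻¹` OF TWO NESTED FAMILIES ON THE V1 TORUS, GIVEN THE ONE-FAMILY MAJORANTS**: for `A₁, A₂, A₃ ≥ 0`, `δ₃ > 0` there are
`δ, C, M₀, N₀ > 0` such that, whenever (i) `P_{f₁,f₂}∘(G[Ω]∇*_ν)`, `P_{f₁,f₂}∘(G[Ω′]∇*_ν)` carry `A₃ψ(a)e^{−δ₃d}`, `A₃ψ′(a)e^{−δ₃d′}` (`ψ′(y) = ψ(y)`),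
(ii) `P_{f₁,f₂}∘G[Ω]` carries `A₁φ(a)e^{−δ₃d}`, (iii) `G[Ω′]∇*_ν` carries `A₂(L^{j(a)}|c_f|⁻¹)e^{−δ₃d′}`, for `f₁ ∈ B(y)`, `supp μ ⊂ B′(y′)`, `|μ| ≤ B`,
`y, y′ ∈ Ω^{(k)}` common top blocks:
`|[(G[Ω]∇*_νμ)(f₁) − (G[Ω]∇*_νμ)(f₂)] − [(G[Ω′]∇*_νμ)(f₁) − (G[Ω′]∇*_νμ)(f₂)]| ≤ C·(√ψ(y)·√(φ(y)·|c_f|L^{−k}))·B·e^{−δ·min(d(y,y′), d′(y,y′))}·e^{−δ·d(y,y′,Ω)}`.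
[cite: Balaban1985BackgroundPropagators, Thm 3.14 (3.153)–(3.154) pp.426–427; Balaban1984PropagatorsII, Prop. 2.6 (2.136)–(2.137) p.247, (2.19)–(2.22) p.226;
Balaban1984PropagatorsI, (1.109)–(1.110) p.35] -/
theorem thm314_Gdiv_holder_flat_V1_of_majorants (d ℓ : ℕ) (hd : 1 ≤ d + 1) (hL : Odd (ℓ + 1) ∧ 1 < ℓ + 1) {b₀ b₁ : ℝ} (hb₀ : 0 < b₀)
    (hb₁ : b₀ ≤ b₁) {A₁ A₂ A₃ δ₃ : ℝ} (hA₁ : 0 ≤ A₁) (hA₂ : 0 ≤ A₂) (hA₃ : 0 ≤ A₃) (hδ₃ : 0 < δ₃) :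
    ∃ δ C M₀ : ℝ, ∃ N₀ : ℕ, 0 < δ ∧ 0 < C ∧ 0 < M₀ ∧ 0 < N₀ ∧
      ∀ (m K : ℕ) {Mh k R : ℕ} {P' : Fin (d + 1) → ℕ}
        (hN : ∀ μ, N0 ℓ Mh k P' μ = (PV d ℓ m K hd hL).sitesPerDir 0) (D D' : TDomains d ℓ Mh k P' R) (hk : k ≤ m + K),
        1 ≤ k → ∀ {a : ℕ}, Mh = (ℓ + 1) ^ a → 8 ≤ Mh → 2 * (ℓ + 1) ^ 2 ≤ R → (∀ μ, 5 * (ℓ + 1) ≤ P' μ) → 4 ≤ ℓ →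
        M₀ ≤ ((ℓ : ℝ) + 1) * Mh → N₀ + 1 ≤ R * ((ℓ + 1) * Mh) →
        ∀ {cf : ℝ} (hcf : cf ≠ 0) {w : BondIdx (domT hN D hk) → ℝ} (hw : ∀ i, 0 < w i)
          {w' : BondIdx (domT hN D' hk) → ℝ} (hw' : ∀ i', 0 < w' i'),
        GlobalBand b₀ b₁ cf w → GlobalBand b₀ b₁ cf w' →
        (∀ (i : BondIdx (domT hN D hk)) (i' : BondIdx (domT hN D' hk)), i.1 = i'.1 → w i = w' i') →
        ∀ (ν : Fin (d + 1)) (f₁ f₂ : PBond (PV d ℓ m K hd hL) 0)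
          (φ ψ : ↥(bset D.toDomains) → ℝ) (ψ' : ↥(bset D'.toDomains) → ℝ),
        (∀ a, 0 ≤ φ a) → (∀ a, 0 ≤ ψ a) → (∀ a', 0 ≤ ψ' a') →
        -- (i) the one-family (2.137)₂ pair majorants of `G∇*_ν` in the two families
        HasMajorant (g := geomT D) (blkV1 hN D)
            (pairOp f₁ f₂ ∘ₗ (onFun (GE (domT hN D hk) hcf hw) * DVa ν cf : Module.End ℝ (PBond (PV d ℓ m K hd hL) 0 → ℝ)))
            (fun a b => A₃ * ψ a * Real.exp (-(δ₃ * (geomT D).dist a b))) →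
        HasMajorant (g := geomT D') (blkV1 hN D')
            (pairOp f₁ f₂ ∘ₗ (onFun (GE (domT hN D' hk) hcf hw') * DVa ν cf : Module.End ℝ (PBond (PV d ℓ m K hd hL) 0 → ℝ)))
            (fun a b => A₃ * ψ' a * Real.exp (-(δ₃ * (geomT D').dist a b))) →
        -- (ii) the one-family pair majorant of `G[Ω]` itself
        HasMajorant (g := geomT D) (blkV1 hN D) (pairOp f₁ f₂ ∘ₗ onFun (GE (domT hN D hk) hcf hw))
            (fun a b => A₁ * φ a * Real.exp (-(δ₃ * (geomT D).dist a b))) →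
        -- (iii) the one-family (2.136)₃ majorant of `G[Ω′]∇*_ν`
        HasMajorant (g := geomT D') (blkV1 hN D') (onFun (GE (domT hN D' hk) hcf hw') * DVa ν cf)
            (fun a b => A₂ * ((geomT D').len a * |cf|⁻¹) * Real.exp (-(δ₃ * (geomT D').dist a b))) →
        ∀ (y : ↥(bset D.toDomains)) (hyD' : y.1 ∈ bset D'.toDomains) (y' : ↥(bset D'.toDomains)) (hy'D : y'.1 ∈ bset D.toDomains),
        y.1.1 = k → y'.1.1 = k → ψ' ⟨y.1, hyD'⟩ = ψ y →
        ∀ (μ : PBond (PV d ℓ m K hd hL) 0 → ℝ) (B : ℝ), BlockSupp (g := geomT D') (blkV1 hN D') μ y' B →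
        blkV1 hN D f₁ = y →
          |((onFun (GE (domT hN D hk) hcf hw) * DVa ν cf : Module.End ℝ (PBond (PV d ℓ m K hd hL) 0 → ℝ)) μ f₁
              - (onFun (GE (domT hN D hk) hcf hw) * DVa ν cf : Module.End ℝ (PBond (PV d ℓ m K hd hL) 0 → ℝ)) μ f₂)
            - ((onFun (GE (domT hN D' hk) hcf hw') * DVa ν cf : Module.End ℝ (PBond (PV d ℓ m K hd hL) 0 → ℝ)) μ f₁
              - (onFun (GE (domT hN D' hk) hcf hw') * DVa ν cf : Module.End ℝ (PBond (PV d ℓ m K hd hL) 0 → ℝ)) μ f₂)|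
            ≤ C * (Real.sqrt (ψ y) * Real.sqrt (φ y * (|cf| * ((((ℓ : ℝ) + 1) ^ k))⁻¹)) * B)
              * Real.exp (-(δ * min ((geomT D).dist y ⟨y'.1, hy'D⟩) ((geomT D').dist ⟨y.1, hyD'⟩ y')))
              * Real.exp (-(δ * dOmega D D' y.1.2 y'.1.2)) := by
  have hℓ : 1 ≤ ℓ := by have := hL.2; omega
  have hL1 : (1 : ℝ) ≤ (ℓ : ℝ) + 1 := by linarith [(Nat.cast_nonneg ℓ : (0 : ℝ) ≤ ℓ)]
  -- p38's threshold `M₂` (the torus sizes of the V1 majorants are part of the printed hypotheses; kept for uniformity with FILES 2–3)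
  obtain ⟨σ₁, hσ₁, hT1⟩ := prop26_2136_grad_kLevel_unconditional_pad_V1 d ℓ hd hL hb₀ hb₁
  obtain ⟨A, M₂, hA, hM₂, -⟩ := hT1 σ₁ hσ₁ le_rfl (1 / 2) (by norm_num) (by norm_num)
  -- the two-family (3.49)₄ difference (gen 19) and the one-family (3.49)₄ (FILE 1) at the printed weights
  have hL2 : (1 : ℝ) < (((ℓ : ℝ) + 1)) ^ 2 := by
    have : (2 : ℝ) ≤ (ℓ : ℝ) + 1 := by
      have : (1 : ℝ) ≤ ℓ := by exact_mod_cast hℓ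
      linarith
    nlinarith
  have hamin : 0 < 1 - ((((ℓ : ℝ) + 1)) ^ 2)⁻¹ := by rw [sub_pos]; exact inv_lt_one_of_one_lt₀ hL2
  obtain ⟨hwin, hrec⟩ := B6Prop22KLevelCensus.KIdx.aPrinted_windows hℓ
  obtain ⟨δ₅, C₅, M₅, N₅, hδ₅, hC₅, hM₅, hN₅, h5⟩ :=
    thm314_P_flat_multiLevelTorus d ℓ hℓ (1 - ((((ℓ : ℝ) + 1)) ^ 2)⁻¹) 1 1 1 hamin one_pos
  obtain ⟨ρ, BP, MP, NP, hρ, hBP, hMP, hNP, hPk⟩ := dPd_le d ℓ hℓ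
  -- the common rate (below the GIVEN rate `δ₃`) and the thresholds of (2.60)/(2.61)
  obtain ⟨δ, hδ0, hδ3, hδ5, hδρ⟩ : ∃ δ : ℝ, 0 < δ ∧ δ ≤ δ₃ ∧ δ ≤ δ₅ ∧ δ ≤ ρ :=
    ⟨min δ₃ (min δ₅ ρ), lt_min hδ₃ (lt_min hδ₅ hρ), min_le_left _ _,
      (min_le_right _ _).trans (min_le_left _ _), (min_le_right _ _).trans (min_le_right _ _)⟩
  obtain ⟨Nc, c, hNc, hc, hcon⟩ := consts_260_261 d ℓ hδ0
  have hb₁0 : 0 ≤ b₁ := hb₀.le.trans hb₁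
  -- the engine constant `Θ = (((d : ℝ) + 1) * c * (C₅ + BP * Real.exp (2 * δ) * (1 + ((ℓ : ℝ) + 1) ^ 2)) + 2 * b₁ * Real.exp (5 / 2 * δ) * (1 + ((ℓ : ℝ) + 1) ^ 2)) * ((ℓ : ℝ) + 1) ^ 2 * c * (A₁ * A₂)` is non-negative
  have hΘ0 : 0 ≤ (((d : ℝ) + 1) * c * (C₅ + BP * Real.exp (2 * δ) * (1 + ((ℓ : ℝ) + 1) ^ 2)) + 2 * b₁ * Real.exp (5 / 2 * δ) * (1 + ((ℓ : ℝ) + 1) ^ 2)) * ((ℓ : ℝ) + 1) ^ 2 * c * (A₁ * A₂) := by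
    positivity
  refine ⟨δ / 4, Real.sqrt (2 * A₃) * Real.sqrt ((((d : ℝ) + 1) * c * (C₅ + BP * Real.exp (2 * δ) * (1 + ((ℓ : ℝ) + 1) ^ 2)) + 2 * b₁ * Real.exp (5 / 2 * δ) * (1 + ((ℓ : ℝ) + 1) ^ 2)) * ((ℓ : ℝ) + 1) ^ 2 * c * (A₁ * A₂)) + 1, max M₂ (max M₅ MP), max Nc (max N₅ NP), by positivity, by positivity,
    lt_max_of_lt_left hM₂, lt_max_of_lt_left hNc, ?_⟩
  -- (the real-valued equation `ψ′(y) = ψ(y)` is introduced only where it is used: `positivity` must not see it)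
  intro m K Mh k R P' hN D D' hk hk1 a hMha hM8 hR2 hP5 hℓ4 hM hRN cf hcf w hw w' hw' hwb hwb' hww ν f₁ f₂ φ ψ ψ' hφ0 hψ0 hψ0'
    hS3 hS3' hP3 hT3' y hyD' y' hy'D hy hy'
  -- sizes
  have hMh1 : 1 ≤ Mh := by omega
  have hMh3 : 3 ≤ Mh := by omega
  have hP1 : ∀ μ, 1 ≤ P' μ := fun μ => le_trans (by omega) (hP5 μ)
  have hP4 : ∀ μ, 4 ≤ P' μ := fun μ => le_trans (by omega) (hP5 μ)
  have hR2' : 2 * (ℓ + 1) ≤ R := le_trans (Nat.mul_le_mul_left 2 (by rw [pow_two]; exact Nat.le_mul_self _)) hR2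
  have hRM1 : 1 ≤ R * ((ℓ + 1) * Mh) := le_trans (Nat.le_add_left 1 _) hRN
  have hM5' : M₅ ≤ ((ℓ : ℝ) + 1) * Mh := ((le_max_left _ _).trans (le_max_right _ _)).trans hM
  have hMP' : MP ≤ ((ℓ : ℝ) + 1) * Mh := ((le_max_right _ _).trans (le_max_right _ _)).trans hM
  have hNc' : Nc + 1 ≤ R * ((ℓ + 1) * Mh) := le_trans (Nat.succ_le_succ (le_max_left _ _)) hRN
  have hN5' : N₅ + 1 ≤ R * ((ℓ + 1) * Mh) := le_trans (Nat.succ_le_succ ((le_max_left _ _).trans (le_max_right _ _))) hRN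
  have hNP' : NP + 1 ≤ R * ((ℓ + 1) * Mh) := le_trans (Nat.succ_le_succ ((le_max_right _ _).trans (le_max_right _ _))) hRN
  obtain ⟨hthr, h261⟩ := hcon k Mh R P' hMh1 hP1 hNc'
  have hd0 : ∀ s t : ↥(bset D.toDomains), 0 ≤ (geomT D).dist s t := (triangle_refl_nonneg_T D hMh1 hP1).2.2
  have hd0' : ∀ s t : ↥(bset D'.toDomains), 0 ≤ (geomT D').dist s t := (triangle_refl_nonneg_T D' hMh1 hP1).2.2
  have hlin0' : ∀ a : ↥(bset D'.toDomains), 0 ≤ (geomT D').len a * |cf|⁻¹ := fun a => by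
    rw [B8Ineq192MultiLevelTorus.geomT_len]; positivity
  -- the GIVEN majorants at the common rate
  have hS : HasMajorant (g := geomT D) (blkV1 hN D)
      (pairOp f₁ f₂ ∘ₗ (onFun (GE (domT hN D hk) hcf hw) * DVa ν cf : Module.End ℝ (PBond (PV d ℓ m K hd hL) 0 → ℝ)))
      (fun a b => A₃ * ψ a * Real.exp (-(δ * (geomT D).dist a b))) :=
    hasMajorant_mono (g := geomT D) (blkV1 hN D) hS3 fun a b =>
      mul_le_mul_of_nonneg_left (Real.exp_le_exp.2 (neg_le_neg (mul_le_mul_of_nonneg_right hδ3 (hd0 a b)))) (mul_nonneg hA₃ (hψ0 a))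
  have hS' : HasMajorant (g := geomT D') (blkV1 hN D')
      (pairOp f₁ f₂ ∘ₗ (onFun (GE (domT hN D' hk) hcf hw') * DVa ν cf : Module.End ℝ (PBond (PV d ℓ m K hd hL) 0 → ℝ)))
      (fun a b => A₃ * ψ' a * Real.exp (-(δ * (geomT D').dist a b))) :=
    hasMajorant_mono (g := geomT D') (blkV1 hN D') hS3' fun a b =>
      mul_le_mul_of_nonneg_left (Real.exp_le_exp.2 (neg_le_neg (mul_le_mul_of_nonneg_right hδ3 (hd0' a b)))) (mul_nonneg hA₃ (hψ0' a))
  have hP : HasMajorant (g := geomT D) (blkV1 hN D) (pairOp f₁ f₂ ∘ₗ onFun (GE (domT hN D hk) hcf hw))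
      (fun a b => A₁ * φ a * Real.exp (-(δ * (geomT D).dist a b))) :=
    hasMajorant_mono (g := geomT D) (blkV1 hN D) hP3 fun a b =>
      mul_le_mul_of_nonneg_left (Real.exp_le_exp.2 (neg_le_neg (mul_le_mul_of_nonneg_right hδ3 (hd0 a b)))) (mul_nonneg hA₁ (hφ0 a))
  have hT' : HasMajorant (g := geomT D') (blkV1 hN D') (onFun (GE (domT hN D' hk) hcf hw') * DVa ν cf)
      (fun a b => A₂ * ((geomT D').len a * |cf|⁻¹) * Real.exp (-(δ * (geomT D').dist a b))) :=
    hasMajorant_mono (g := geomT D') (blkV1 hN D') hT3' fun a b =>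
      mul_le_mul_of_nonneg_left (Real.exp_le_exp.2 (neg_le_neg (mul_le_mul_of_nonneg_right hδ3 (hd0' a b)))) (mul_nonneg hA₂ (hlin0' a))
  -- the resolvent identity composed with `P_{f₁,f₂}` on the left and `∇*_ν` on the right
  have hres : pairOp f₁ f₂ ∘ₗ (onFun (GE (domT hN D hk) hcf hw) * DVa ν cf : Module.End ℝ (PBond (PV d ℓ m K hd hL) 0 → ℝ))
        - pairOp f₁ f₂ ∘ₗ (onFun (GE (domT hN D' hk) hcf hw') * DVa ν cf : Module.End ℝ (PBond (PV d ℓ m K hd hL) 0 → ℝ))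
      = (pairOp f₁ f₂ ∘ₗ onFun (GE (domT hN D hk) hcf hw)) ∘ₗ (VP hN D D' cf + VQ hN D D' hk w w')
          ∘ₗ (onFun (GE (domT hN D' hk) hcf hw') * DVa ν cf : Module.End ℝ (PBond (PV d ℓ m K hd hL) 0 → ℝ)) := by
    rw [← LinearMap.comp_sub, ← sub_mul, onFun_GE_sub hN D D' hk hℓ hMh1 hP1 hcf hw hw']
    simp only [Module.End.mul_eq_comp, LinearMap.comp_assoc]
  -- the two-family (3.49)₄ difference at the common rate
  have hΔ : ∀ (p q : ℕ × (Fin (d + 1) → ℤ)) (hpD : p ∈ bset D.toDomains) (hpD' : p ∈ bset D'.toDomains)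
      (hqD : q ∈ bset D.toDomains) (hqD' : q ∈ bset D'.toDomains), p.1 = k → q.1 = k →
      ∀ (x x' : ↥(boxDom (N0 ℓ Mh k P'))), blkOf D.toDomains x = ⟨p, hpD⟩ → blkOf D.toDomains x' = ⟨q, hqD⟩ →
      ∀ μ ν : Fin (d + 1), |dPd D μ ν x x' - dPd D' μ ν x x'|
        ≤ C₅ * ((((ℓ : ℝ) + 1) ^ k) ^ 2)⁻¹ * ((((ℓ : ℝ) + 1) ^ k) ^ (d + 1))⁻¹
          * Real.exp (-(δ * min ((geomT D).dist ⟨p, hpD⟩ ⟨q, hqD⟩) ((geomT D').dist ⟨p, hpD'⟩ ⟨q, hqD'⟩)))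
          * Real.exp (-(δ * dOmega D D' p.2 q.2)) := by
    intro p q hpD hpD' hqD hqD' hp hq x₁ x₂ hx₁ hx₂ μ₁ ν₁
    obtain ⟨-, -, -, h4⟩ := h5 k Mh R hMh3 hM5' hR2' hN5' P' hP1 hP4 D D' (aPrinted ℓ 1) (fun _ => 1) hwin
      (fun i _ => ⟨le_rfl, le_rfl⟩) hrec p q hpD hpD' hqD hqD' hp hq x₁ x₂ hx₁ hx₂
    have h := h4 μ₁ ν₁
    rw [member4_eq_dPd, member4_eq_dPd] at h
    refine h.trans ?_
    have h0 : 0 ≤ C₅ * ((((ℓ : ℝ) + 1) ^ k) ^ 2)⁻¹ * ((((ℓ : ℝ) + 1) ^ k) ^ (d + 1))⁻¹ := by positivity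
    have hm0 : 0 ≤ min ((geomT D).dist ⟨p, hpD⟩ ⟨q, hqD⟩) ((geomT D').dist ⟨p, hpD'⟩ ⟨q, hqD'⟩) := le_min (hd0 _ _) (hd0' _ _)
    have hΩ0 : 0 ≤ dOmega D D' p.2 q.2 := dOmega_nonneg D D' _ _
    have e1 : Real.exp (-(δ₅ * min ((geomT D).dist ⟨p, hpD⟩ ⟨q, hqD⟩) ((geomT D').dist ⟨p, hpD'⟩ ⟨q, hqD'⟩)))
        ≤ Real.exp (-(δ * min ((geomT D).dist ⟨p, hpD⟩ ⟨q, hqD⟩) ((geomT D').dist ⟨p, hpD'⟩ ⟨q, hqD'⟩))) :=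
      Real.exp_le_exp.2 (neg_le_neg (mul_le_mul_of_nonneg_right hδ5 hm0))
    have e2 : Real.exp (-(δ₅ * dOmega D D' p.2 q.2)) ≤ Real.exp (-(δ * dOmega D D' p.2 q.2)) :=
      Real.exp_le_exp.2 (neg_le_neg (mul_le_mul_of_nonneg_right hδ5 hΩ0))
    exact mul_le_mul (mul_le_mul_of_nonneg_left e1 h0) e2 (Real.exp_pos _).le (mul_nonneg h0 (Real.exp_pos _).le)
  -- the one-family (3.49)₄ bounds at the common rate
  have hPD : ∀ (μ ν : Fin (d + 1)) (x x' : ↥(boxDom (N0 ℓ Mh k P'))),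
      |dPd D μ ν x x'| ≤ BP * ((((ℓ : ℝ) + 1) ^ D.lev x.1) ^ 2)⁻¹ * (W D.toDomains (blkOf D.toDomains x'))⁻¹ *
        Real.exp (-(δ * (geomT D).dist (blkOf D.toDomains x) (blkOf D.toDomains x'))) := by
    intro μ₁ ν₁ x₁ x₂
    refine (hPk k Mh R hMh3 hMP' hR2' hNP' P' hP4 D μ₁ ν₁ x₁ x₂).trans ?_
    have hW0 : 0 < W D.toDomains (blkOf D.toDomains x₂) := W_pos _ _
    exact mul_le_mul_of_nonneg_left (Real.exp_le_exp.2 (neg_le_neg (mul_le_mul_of_nonneg_right hδρ (hd0 _ _)))) (by positivity)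
  have hPD' : ∀ (μ ν : Fin (d + 1)) (x x' : ↥(boxDom (N0 ℓ Mh k P'))),
      |dPd D' μ ν x x'| ≤ BP * ((((ℓ : ℝ) + 1) ^ D'.lev x.1) ^ 2)⁻¹ * (W D'.toDomains (blkOf D'.toDomains x'))⁻¹ *
        Real.exp (-(δ * (geomT D').dist (blkOf D'.toDomains x) (blkOf D'.toDomains x'))) := by
    intro μ₁ ν₁ x₁ x₂
    refine (hPk k Mh R hMh3 hMP' hR2' hNP' P' hP4 D' μ₁ ν₁ x₁ x₂).trans ?_
    have hW0 : 0 < W D'.toDomains (blkOf D'.toDomains x₂) := W_pos _ _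
    exact mul_le_mul_of_nonneg_left (Real.exp_le_exp.2 (neg_le_neg (mul_le_mul_of_nonneg_right hδρ (hd0' _ _)))) (by positivity)
  -- the weights
  have hw0 : ∀ i, 0 ≤ w i := fun i => (hw i).le
  have hw0' : ∀ i', 0 ≤ w' i' := fun i' => (hw' i').le
  have hwB := fun i => w_le_of_band hN D hk hcf hwb i
  have hwB' := fun i' => w_le_of_band hN D' hk hcf hwb' i'
  have hκ0 : 0 ≤ |cf| * ((((ℓ : ℝ) + 1) ^ k))⁻¹ := by positivity
  intro hψ μ B hμ hf₁
  -- the inner profile: the output of `G[Ω′]∇*_ν` on `μ`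
  have hg : ∀ v, |(onFun (GE (domT hN D' hk) hcf hw') * DVa ν cf : Module.End ℝ (PBond (PV d ℓ m K hd hL) 0 → ℝ)) μ v|
      ≤ A₂ * ((geomT D').len (blkV1 hN D' v) * |cf|⁻¹) * Real.exp (-(δ * (geomT D').dist (blkV1 hN D' v) y')) * B :=
    fun v => hT' y' μ B hμ v
  -- `(P_{f₁,f₂}T μ)(f₁) = (Tμ)(f₁) − (Tμ)(f₂)`
  have eP : ∀ S : (PBond (PV d ℓ m K hd hL) 0 → ℝ) →ₗ[ℝ] (PBond (PV d ℓ m K hd hL) 0 → ℝ),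
      (pairOp f₁ f₂ ∘ₗ S) μ f₁ = S μ f₁ - S μ f₂ := fun S => by
    rw [LinearMap.comp_apply, pairOp_apply, if_pos rfl]
  -- the plain-decay half: majorants (i)
  have h1 := trivial_bound_gen hN D D' hδ0.le hA₃ (φ := ψ) (φ' := ψ') hψ0 hS hS' hyD' hy'D hψ hμ f₁ hf₁
  rw [eP, eP] at h1
  clear hψ
  -- the engine half: outer `P∘G[Ω]` (majorant (ii)), inner profile (iii)
  have h2 := engine_lin hN D D' hk hk1 hMh1 hP1 hRM1 hδ0.le hcf hC₅.le hBP.le hb₁0 hA₂ hμ.nonneg hc hthr (h261 D) (h261 D') hΔ hPD hPD'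
    hw0 hw0' hwB hwB' hww hA₁ (φ := φ) hφ0 hP hy hy' hg f₁ hf₁
  have hEq : (pairOp f₁ f₂ ∘ₗ (onFun (GE (domT hN D hk) hcf hw) * DVa ν cf : Module.End ℝ (PBond (PV d ℓ m K hd hL) 0 → ℝ))) μ f₁
        - (pairOp f₁ f₂ ∘ₗ (onFun (GE (domT hN D' hk) hcf hw') * DVa ν cf : Module.End ℝ (PBond (PV d ℓ m K hd hL) 0 → ℝ))) μ f₁
      = (pairOp f₁ f₂ ∘ₗ onFun (GE (domT hN D hk) hcf hw))
          ((VP hN D D' cf + VQ hN D D' hk w w') ((onFun (GE (domT hN D' hk) hcf hw') * DVa ν cf : Module.End ℝ (PBond (PV d ℓ m K hd hL) 0 → ℝ)) μ)) f₁ := by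
    have h := congrFun (LinearMap.congr_fun hres μ) f₁
    rw [LinearMap.sub_apply, Pi.sub_apply, LinearMap.comp_apply, LinearMap.comp_apply] at h
    exact h
  rw [eP, eP] at hEq
  rw [← hEq] at h2
  -- both halves in the shape of `combined_bound`
  have h1' := le_of_le_of_eq h1 (show 2 * A₃ * (ψ y * B) * Real.exp (-(δ * min ((geomT D).dist y ⟨y'.1, hy'D⟩) ((geomT D').dist ⟨y.1, hyD'⟩ y')))
      = (2 * A₃ * ψ y) * B * Real.exp (-(δ * min ((geomT D).dist y ⟨y'.1, hy'D⟩) ((geomT D').dist ⟨y.1, hyD'⟩ y'))) by ring)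
  have h2' := le_of_le_of_eq h2 (show (((d : ℝ) + 1) * c * (C₅ + BP * Real.exp (2 * δ) * (1 + ((ℓ : ℝ) + 1) ^ 2)) + 2 * b₁ * Real.exp (5 / 2 * δ) * (1 + ((ℓ : ℝ) + 1) ^ 2)) * ((ℓ : ℝ) + 1) ^ 2 * c * (A₁ * A₂) * B * (|cf| * ((((ℓ : ℝ) + 1) ^ k))⁻¹) * φ y * Real.exp (-(1 / 2 * δ * dOmega D D' y.1.2 y'.1.2))
      = ((((d : ℝ) + 1) * c * (C₅ + BP * Real.exp (2 * δ) * (1 + ((ℓ : ℝ) + 1) ^ 2)) + 2 * b₁ * Real.exp (5 / 2 * δ) * (1 + ((ℓ : ℝ) + 1) ^ 2)) * ((ℓ : ℝ) + 1) ^ 2 * c * (A₁ * A₂) * (φ y * (|cf| * ((((ℓ : ℝ) + 1) ^ k))⁻¹))) * B * Real.exp (-(1 / 2 * δ * dOmega D D' y.1.2 y'.1.2)) by ring)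
  have hmain := combined_bound (mul_nonneg (mul_nonneg zero_le_two hA₃) (hψ0 y)) (mul_nonneg hΘ0 (mul_nonneg (hφ0 y) hκ0)) hμ.nonneg h1' h2'
  refine hmain.trans ?_
  clear hmain h1' h2' h1 h2 hEq hg
  -- `√(2A₃ψ)·√(Θφκ) = (√(2A₃)√Θ)·(√ψ·√(φκ))`, the rates `½δ`, `¼δ` weakened to `δ/4`, the constant enlarged by `1`
  have hsq : Real.sqrt (2 * A₃ * ψ y) * Real.sqrt ((((d : ℝ) + 1) * c * (C₅ + BP * Real.exp (2 * δ) * (1 + ((ℓ : ℝ) + 1) ^ 2)) + 2 * b₁ * Real.exp (5 / 2 * δ) * (1 + ((ℓ : ℝ) + 1) ^ 2)) * ((ℓ : ℝ) + 1) ^ 2 * c * (A₁ * A₂) * (φ y * (|cf| * ((((ℓ : ℝ) + 1) ^ k))⁻¹))) * B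
      = Real.sqrt (2 * A₃) * Real.sqrt ((((d : ℝ) + 1) * c * (C₅ + BP * Real.exp (2 * δ) * (1 + ((ℓ : ℝ) + 1) ^ 2)) + 2 * b₁ * Real.exp (5 / 2 * δ) * (1 + ((ℓ : ℝ) + 1) ^ 2)) * ((ℓ : ℝ) + 1) ^ 2 * c * (A₁ * A₂)) * (Real.sqrt (ψ y) * Real.sqrt (φ y * (|cf| * ((((ℓ : ℝ) + 1) ^ k))⁻¹)) * B) := by
    rw [Real.sqrt_mul (mul_nonneg zero_le_two hA₃) (ψ y), Real.sqrt_mul hΘ0]; ring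
  rw [hsq]
  have hF : 0 ≤ Real.sqrt (ψ y) * Real.sqrt (φ y * (|cf| * ((((ℓ : ℝ) + 1) ^ k))⁻¹)) * B :=
    mul_nonneg (mul_nonneg (Real.sqrt_nonneg _) (Real.sqrt_nonneg _)) hμ.nonneg
  have hm0 : 0 ≤ min ((geomT D).dist y ⟨y'.1, hy'D⟩) ((geomT D').dist ⟨y.1, hyD'⟩ y') := le_min (hd0 _ _) (hd0' _ _)
  have e1 : Real.exp (-(1 / 2 * δ * min ((geomT D).dist y ⟨y'.1, hy'D⟩) ((geomT D').dist ⟨y.1, hyD'⟩ y')))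
      ≤ Real.exp (-(δ / 4 * min ((geomT D).dist y ⟨y'.1, hy'D⟩) ((geomT D').dist ⟨y.1, hyD'⟩ y'))) :=
    Real.exp_le_exp.2 (by have h := mul_nonneg hδ0.le hm0; linarith only [h])
  have e2 : Real.exp (-(1 / 4 * δ * dOmega D D' y.1.2 y'.1.2)) = Real.exp (-(δ / 4 * dOmega D D' y.1.2 y'.1.2)) := by
    congr 1; ring
  have hK0 : 0 ≤ Real.sqrt (2 * A₃) * Real.sqrt ((((d : ℝ) + 1) * c * (C₅ + BP * Real.exp (2 * δ) * (1 + ((ℓ : ℝ) + 1) ^ 2)) + 2 * b₁ * Real.exp (5 / 2 * δ) * (1 + ((ℓ : ℝ) + 1) ^ 2)) * ((ℓ : ℝ) + 1) ^ 2 * c * (A₁ * A₂)) := mul_nonneg (Real.sqrt_nonneg _) (Real.sqrt_nonneg _)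
  have hK1 : Real.sqrt (2 * A₃) * Real.sqrt ((((d : ℝ) + 1) * c * (C₅ + BP * Real.exp (2 * δ) * (1 + ((ℓ : ℝ) + 1) ^ 2)) + 2 * b₁ * Real.exp (5 / 2 * δ) * (1 + ((ℓ : ℝ) + 1) ^ 2)) * ((ℓ : ℝ) + 1) ^ 2 * c * (A₁ * A₂)) ≤ Real.sqrt (2 * A₃) * Real.sqrt ((((d : ℝ) + 1) * c * (C₅ + BP * Real.exp (2 * δ) * (1 + ((ℓ : ℝ) + 1) ^ 2)) + 2 * b₁ * Real.exp (5 / 2 * δ) * (1 + ((ℓ : ℝ) + 1) ^ 2)) * ((ℓ : ℝ) + 1) ^ 2 * c * (A₁ * A₂)) + 1 := le_add_of_nonneg_right zero_le_one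
  rw [e2]
  exact mul_le_mul (mul_le_mul (mul_le_mul_of_nonneg_right hK1 hF) e1 (Real.exp_pos _).le
    (mul_nonneg (hK0.trans hK1) hF)) le_rfl (Real.exp_pos _).le
    (mul_nonneg (mul_nonneg (hK0.trans hK1) hF) (Real.exp_pos _).le)

end Literature.MathematicalPhysics.QuantumFieldTheory.Balaban1983to89.B9Thm314GFlatV1DivHolder

end
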